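import Literature.MathematicalPhysics.QuantumLattice.HubbardFermiRadiusBandSmooth
import Mathlib.Analysis.SpecialFunctions.Complex.Arg
import Mathlib.Analysis.SpecialFunctions.Trigonometric.Angle
import Mathlib.Analysis.InnerProductSpace.Calculus
import HarnessLib

/-!
# The polar parametrisation `θ ↦ u_μ(θ)(cos θ, sin θ)` of the Fermi curve: a `C¹` embedded circle

Topic `Literature/MathematicalPhysics/QuantumLattice`; continues `HubbardFermiRadiusBand.lean`
(`fermiPolar μ θ = u_μ(θ) · dir θ ∈ ℝ²`, `-4 < μ < 0`). The facts a change of variables to the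
angle needs:

* `fermiPolar_add_two_pi`, `fermiPolar_add_pi` (`= -fermiPolar`), periodicity and inversion;
* `exists_fermiPolar_eq` — **every point `k` of the closed square `‖k‖_∞ ≤ π` on the level set
  `ε(k) = μ` is `fermiPolar μ θ` for some `θ ∈ (-π, π]`** (polar decomposition via `Complex.arg`);
* `fermiPolar_eq_fermiPolar_iff` — `fermiPolar μ θ₁ = fermiPolar μ θ₂ ↔ θ₁ = θ₂ (mod 2π)`, hence
  `injOn_fermiPolar` on every set of diameter `< 2π`;
* `hasDerivAt_fermiPolar` — the velocity is `fermiPolarVelocity μ θ = u' dir θ + u dir θ^⊥`;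
  `continuous_fermiPolarVelocity`, `continuous_fermiPolarDOS` and the jointly continuous versions
  `continuousOn_fermiPolarVelocity`, `continuousOn_fermiPolar_uncurry`,
  `continuousOn_fermiPolarDOS_uncurry` on `(-4, 0) × ℝ`.

Everything is proved; no definitions. [folklore]
-/

noncomputable section

open Real Set Filter
open scoped Topology

namespace Literature.MathematicalPhysics.QuantumLattice

section Polar

variable {μ : ℝ} (hμ₁ : -4 < μ) (hμ₂ : μ < 0)
include hμ₁ hμ₂

/-! ### Periodicity and inversion -/

/-- `fermiPolar μ (θ + 2π) = fermiPolar μ θ`. [folklore] -/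
theorem fermiPolar_add_two_pi (θ : ℝ) : fermiPolar μ (θ + 2 * π) = fermiPolar μ θ := by
  have h := bandFermiRadius_add_two_pi hμ₁ hμ₂ θ
  apply (WithLp.ofLp_injective 2).eq_iff.1
  simp only [ofLp_fermiPolar, h]
  ext i; fin_cases i <;> simp [dir, Real.cos_add_two_pi, Real.sin_add_two_pi]

/-- `fermiPolar μ (θ + 2kπ) = fermiPolar μ θ`. [folklore] -/
theorem fermiPolar_add_int_mul_two_pi (θ : ℝ) (k : ℤ) :
    fermiPolar μ (θ + k * (2 * π)) = fermiPolar μ θ := by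
  have h := bandFermiRadius_add_int_mul_two_pi hμ₁ hμ₂ θ k
  apply (WithLp.ofLp_injective 2).eq_iff.1
  simp only [ofLp_fermiPolar, h]
  ext i; fin_cases i <;> simp [dir, Real.cos_add_int_mul_two_pi, Real.sin_add_int_mul_two_pi]

/-- **Inversion**: `fermiPolar μ (θ + π) = -fermiPolar μ θ`. [folklore] -/
theorem fermiPolar_add_pi (θ : ℝ) : fermiPolar μ (θ + π) = -fermiPolar μ θ := by
  have h := bandFermiRadius_add_pi hμ₁ hμ₂ θ
  apply (WithLp.ofLp_injective 2).eq_iff.1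
  rw [WithLp.ofLp_neg]
  simp only [ofLp_fermiPolar, h]
  ext i; fin_cases i <;> simp [dir, Real.cos_add_pi, Real.sin_add_pi]

/-! ### Surjectivity onto the level set -/

/-- **Polar decomposition of the level set**: a point `k` of the closed square `‖k‖_∞ ≤ π` with
`ε(k) = μ` is `fermiPolar μ θ` with `θ = arg(k₁ + i k₂) ∈ (-π, π]`. [folklore] -/
theorem exists_fermiPolar_eq {k : EuclideanSpace ℝ (Fin 2)} (hk : ‖WithLp.ofLp k‖ ≤ π)
    (he : sqDispersion (WithLp.ofLp k) = μ) : ∃ θ ∈ Ioc (-π) π, fermiPolar μ θ = k := by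
  set z : ℂ := ⟨k 0, k 1⟩ with hz
  have hz0 : z ≠ 0 := by
    intro h0
    have h00 : k 0 = 0 := by simpa [hz] using congrArg Complex.re h0
    have h01 : k 1 = 0 := by simpa [hz] using congrArg Complex.im h0
    have : sqDispersion (WithLp.ofLp k) = -4 := by
      simp [sqDispersion, h00, h01]; norm_num
    linarith
  set θ := Complex.arg z with hθ
  set r := ‖z‖ with hr
  have hrpos : 0 < r := norm_pos_iff.2 hz0
  have hcos : r * Real.cos θ = k 0 := by
    rw [hθ, Complex.cos_arg hz0, hr, mul_div_cancel₀ _ (norm_ne_zero_iff.2 hz0)]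
  have hsin : r * Real.sin θ = k 1 := by
    rw [hθ, Complex.sin_arg, hr, mul_div_cancel₀ _ (norm_ne_zero_iff.2 hz0)]
  have hvec : r • dir θ = WithLp.ofLp k := by
    ext i; fin_cases i
    · simpa using hcos
    · simpa using hsin
  have hroot : IsBandFermiRadius μ θ r := by
    refine ⟨⟨hrpos.le, ?_⟩, ?_⟩
    · rw [← norm_smul_dir hrpos.le, hvec]; exact hk
    · show sqDispersion (r • dir θ) = μ
      rw [hvec]; exact he
  refine ⟨θ, Complex.arg_mem_Ioc z, ?_⟩
  apply (WithLp.ofLp_injective 2).eq_iff.1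
  rw [ofLp_fermiPolar, ← bandFermiRadius_unique hμ₁ hμ₂ hroot, hvec]

/-! ### Injectivity modulo `2π` -/

/-- `fermiPolar μ θ₁ = fermiPolar μ θ₂ ↔ θ₁ = θ₂ (mod 2π)`. [folklore] -/
theorem fermiPolar_eq_fermiPolar_iff {θ₁ θ₂ : ℝ} :
    fermiPolar μ θ₁ = fermiPolar μ θ₂ ↔ (θ₁ : Real.Angle) = θ₂ := by
  constructor
  · intro h
    have hn : bandFermiRadius μ θ₁ = bandFermiRadius μ θ₂ := by
      rw [← norm_fermiPolar hμ₁ hμ₂ θ₁, ← norm_fermiPolar hμ₁ hμ₂ θ₂, h]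
    have hR := bandFermiRadius_pos hμ₁ hμ₂ θ₂
    have h0 := congrArg (fun v : EuclideanSpace ℝ (Fin 2) => v 0) h
    have h1 := congrArg (fun v : EuclideanSpace ℝ (Fin 2) => v 1) h
    simp only [fermiPolar_apply_zero, fermiPolar_apply_one, hn] at h0 h1
    have hc : Real.cos θ₁ = Real.cos θ₂ := mul_left_cancel₀ hR.ne' h0
    have hs : Real.sin θ₁ = Real.sin θ₂ := mul_left_cancel₀ hR.ne' h1
    exact Real.Angle.cos_sin_inj hc hs
  · intro h
    obtain ⟨k, hk⟩ := Real.Angle.angle_eq_iff_two_pi_dvd_sub.1 h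
    have : θ₁ = θ₂ + k * (2 * π) := by linarith
    rw [this, fermiPolar_add_int_mul_two_pi hμ₁ hμ₂]

/-- **Injectivity on sets of diameter `< 2π`.** [folklore] -/
theorem injOn_fermiPolar {s : Set ℝ} (hs : ∀ θ₁ ∈ s, ∀ θ₂ ∈ s, |θ₁ - θ₂| < 2 * π) :
    InjOn (fermiPolar μ) s := by
  intro θ₁ h₁ θ₂ h₂ h
  obtain ⟨k, hk⟩ := Real.Angle.angle_eq_iff_two_pi_dvd_sub.1
    ((fermiPolar_eq_fermiPolar_iff hμ₁ hμ₂).1 h)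
  have hlt := hs θ₁ h₁ θ₂ h₂
  rw [hk, abs_mul, abs_of_pos Real.two_pi_pos] at hlt
  have hk1 : |(k : ℝ)| < 1 := by
    by_contra hc
    have hc : 1 ≤ |(k : ℝ)| := le_of_not_gt hc
    nlinarith [Real.two_pi_pos]
  have hk0 : k = 0 := by
    have : |k| < 1 := by exact_mod_cast hk1
    exact Int.abs_lt_one_iff.1 this
  rw [hk0] at hk
  simp at hk
  linarith

/-- Injectivity on open intervals of length `≤ 2π`. [folklore] -/
theorem injOn_fermiPolar_Ioo {a b : ℝ} (hab : b - a ≤ 2 * π) : InjOn (fermiPolar μ) (Ioo a b) :=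
  injOn_fermiPolar hμ₁ hμ₂ fun θ₁ h₁ θ₂ h₂ => by
    rw [abs_lt]; constructor <;> linarith [h₁.1, h₁.2, h₂.1, h₂.2]

/-! ### The velocity -/

omit hμ₁ hμ₂ in
/-- The derivative of `dir`: `dir' θ = (-sin θ, cos θ)`. [folklore] -/
theorem hasDerivAt_dir (θ : ℝ) : HasDerivAt dir ![-Real.sin θ, Real.cos θ] θ := by
  refine hasDerivAt_pi.2 fun i => ?_
  fin_cases i
  · simpa using Real.hasDerivAt_cos θ
  · simpa using Real.hasDerivAt_sin θ

/-- **The velocity of the polar parametrisation**: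
`(d/dθ) fermiPolar μ θ = fermiPolarVelocity μ θ = u'(θ) dir θ + u(θ) dir^⊥ θ`. [folklore] -/
theorem hasDerivAt_fermiPolar (θ : ℝ) :
    HasDerivAt (fermiPolar μ) (fermiPolarVelocity μ θ) θ := by
  have hu : HasDerivAt (bandFermiRadius μ) (bandFermiRadiusDeriv μ θ) θ :=
    hasDerivAt_bandFermiRadius hμ₁ hμ₂ θ
  have hg : HasDerivAt (fun ϑ => bandFermiRadius μ ϑ • dir ϑ)
      (bandFermiRadius μ θ • ![-Real.sin θ, Real.cos θ] + bandFermiRadiusDeriv μ θ • dir θ) θ :=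
    hu.smul (hasDerivAt_dir θ)
  set L : (Fin 2 → ℝ) →L[ℝ] EuclideanSpace ℝ (Fin 2) :=
    (PiLp.continuousLinearEquiv 2 ℝ (fun _ : Fin 2 => ℝ)).symm.toContinuousLinearMap with hL
  have hcomp : HasDerivAt (fun ϑ => L (bandFermiRadius μ ϑ • dir ϑ))
      (L (bandFermiRadius μ θ • ![-Real.sin θ, Real.cos θ] + bandFermiRadiusDeriv μ θ • dir θ)) θ :=
    L.hasFDerivAt.comp_hasDerivAt θ hg
  have hfun : (fun ϑ => L (bandFermiRadius μ ϑ • dir ϑ)) = fermiPolar μ := by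
    funext ϑ; rfl
  rw [hfun] at hcomp
  convert hcomp using 1
  rw [add_comm]
  rfl

/-- The velocity is continuous in the angle. [folklore] -/
theorem continuous_fermiPolarVelocity : Continuous (fermiPolarVelocity μ) := by
  have hd : Continuous dir := by
    refine continuous_pi fun i => ?_
    fin_cases i <;> simp [dir] <;> fun_prop
  have hd' : Continuous fun θ : ℝ => (![-Real.sin θ, Real.cos θ] : Fin 2 → ℝ) := by
    refine continuous_pi fun i => ?_
    fin_cases i <;> simp <;> fun_prop
  unfold fermiPolarVelocity
  refine (PiLp.continuous_toLp 2 _).comp ?_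
  exact ((continuous_bandFermiRadiusDeriv hμ₁ hμ₂).smul hd).add
    ((continuous_bandFermiRadius hμ₁ hμ₂).smul hd')

/-- `fermiPolar μ` is continuous. [folklore] -/
theorem continuous_fermiPolar : Continuous (fermiPolar μ) := by
  have hd : Continuous dir := by
    refine continuous_pi fun i => ?_
    fin_cases i <;> simp [dir] <;> fun_prop
  exact (PiLp.continuous_toLp 2 _).comp ((continuous_bandFermiRadius hμ₁ hμ₂).smul hd)

/-- **The density of states is continuous in the angle.** [folklore] -/
theorem continuous_fermiPolarDOS : Continuous (fermiPolarDOS μ) := by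
  unfold fermiPolarDOS
  refine (continuous_fermiPolarVelocity hμ₁ hμ₂).norm.div ?_ fun θ => ?_
  · have h0 : Continuous fun θ => fermiPolar μ θ 0 := (PiLp.continuous_apply 2 _ 0).comp (continuous_fermiPolar hμ₁ hμ₂)
    have h1 : Continuous fun θ => fermiPolar μ θ 1 := (PiLp.continuous_apply 2 _ 1).comp (continuous_fermiPolar hμ₁ hμ₂)
    exact continuous_const.mul (((Real.continuous_sin.comp h0).pow 2).add ((Real.continuous_sin.comp h1).pow 2)).sqrt
  · exact (mul_pos two_pos (Real.sqrt_pos.2 (sin_sq_add_sin_sq_fermiPolar_pos hμ₁ hμ₂ θ))).ne'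

end Polar

/-- **Joint continuity of the velocity in `(μ, θ)`** on `(-4, 0) × ℝ`. [folklore] -/
theorem continuousOn_fermiPolarVelocity :
    ContinuousOn (fun p : ℝ × ℝ => fermiPolarVelocity p.1 p.2) (Ioo (-4 : ℝ) 0 ×ˢ univ) := by
  have hd : Continuous fun p : ℝ × ℝ => dir p.2 := by
    refine continuous_pi fun i => ?_
    fin_cases i <;> simp [dir] <;> fun_prop
  have hd' : Continuous fun p : ℝ × ℝ => (![-Real.sin p.2, Real.cos p.2] : Fin 2 → ℝ) := by
    refine continuous_pi fun i => ?_
    fin_cases i <;> simp <;> fun_prop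
  unfold fermiPolarVelocity
  refine (PiLp.continuous_toLp 2 _).comp_continuousOn ?_
  exact (continuousOn_bandFermiRadius_angleDeriv.smul hd.continuousOn).add
    (continuousOn_bandFermiRadius.smul hd'.continuousOn)

/-- **Joint continuity of the polar point in `(μ, θ)`** on `(-4, 0) × ℝ`. [folklore] -/
theorem continuousOn_fermiPolar_uncurry :
    ContinuousOn (fun p : ℝ × ℝ => fermiPolar p.1 p.2) (Ioo (-4 : ℝ) 0 ×ˢ univ) := by
  have hd : Continuous fun p : ℝ × ℝ => dir p.2 := by
    refine continuous_pi fun i => ?_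
    fin_cases i <;> simp [dir] <;> fun_prop
  exact (PiLp.continuous_toLp 2 _).comp_continuousOn (continuousOn_bandFermiRadius.smul hd.continuousOn)

/-- **Joint continuity of the density of states in `(μ, θ)`** on `(-4, 0) × ℝ`. [folklore] -/
theorem continuousOn_fermiPolarDOS_uncurry :
    ContinuousOn (fun p : ℝ × ℝ => fermiPolarDOS p.1 p.2) (Ioo (-4 : ℝ) 0 ×ˢ univ) := by
  unfold fermiPolarDOS
  have hγ := continuousOn_fermiPolar_uncurry
  have h0₀ := (PiLp.continuous_apply 2 (fun _ : Fin 2 => ℝ) 0).comp_continuousOn hγ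
  have h0 : ContinuousOn (fun p : ℝ × ℝ => fermiPolar p.1 p.2 0) (Ioo (-4 : ℝ) 0 ×ˢ univ) := h0₀
  have h1₀ := (PiLp.continuous_apply 2 (fun _ : Fin 2 => ℝ) 1).comp_continuousOn hγ
  have h1 : ContinuousOn (fun p : ℝ × ℝ => fermiPolar p.1 p.2 1) (Ioo (-4 : ℝ) 0 ×ˢ univ) := h1₀
  have hs0₀ := Real.continuous_sin.comp_continuousOn h0
  have hs0 : ContinuousOn (fun p : ℝ × ℝ => Real.sin (fermiPolar p.1 p.2 0)) (Ioo (-4 : ℝ) 0 ×ˢ univ) := hs0₀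
  have hs1₀ := Real.continuous_sin.comp_continuousOn h1
  have hs1 : ContinuousOn (fun p : ℝ × ℝ => Real.sin (fermiPolar p.1 p.2 1)) (Ioo (-4 : ℝ) 0 ×ˢ univ) := hs1₀
  have hden : ContinuousOn (fun p : ℝ × ℝ =>
      2 * Real.sqrt (Real.sin (fermiPolar p.1 p.2 0) ^ 2 + Real.sin (fermiPolar p.1 p.2 1) ^ 2))
      (Ioo (-4 : ℝ) 0 ×ˢ univ) :=
    continuousOn_const.mul ((hs0.pow 2).add (hs1.pow 2)).sqrt
  refine continuousOn_fermiPolarVelocity.norm.div hden fun p hp => ?_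
  exact (mul_pos two_pos (Real.sqrt_pos.2 (sin_sq_add_sin_sq_fermiPolar_pos hp.1.1 hp.1.2 p.2))).ne'

end Literature.MathematicalPhysics.QuantumLattice

end
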